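import Mathlib.Topology.Connected.Basic
import HarnessLib

/-!
# An open cover of a connected set is chain-connected

General topology (e.g. J. Munkres, *Topology*, 2nd ed., §23 Exercise 11 style; N. Bourbaki,
*Topologie générale*, I §11 n°1, the «enchaînement» characterisation; A. Hatcher, *Algebraic
Topology* (2002), §3.3 p. 235, "any two points are joined by a finite sequence of such balls"):
if `S` is preconnected and covered by open sets `U i`, then for `s ∈ S ∩ U i` and `t ∈ S ∩ U j`
there is a finite chain `i = i₀, i₁, …, iₙ = j` with `U iₗ ∩ U iₗ₊₁ ∩ S ≠ ∅`
(`IsPreconnected.reflTransGen_of_subset_iUnion`). Mathlib has the converse direction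
(`IsPreconnected.iUnion_of_reflTransGen`: chain-linked unions of preconnected sets are
preconnected) but not this one (searched `ReflTransGen` in `Topology/Connected`).

Consumer: the cyclicity of the Thom-degree local homology of a connected locally flat closed
subset (`AlgebraicTopology/SingularHomology`): local fundamental classes at two points of `S` are
compared along such a chain of straightened balls.

## References

* [HatcherAT2002] A. Hatcher, Algebraic Topology, CUP 2002, §3.3 p. 235.
-/

namespace Literature.Topology

open Set Relation

/-- **An open cover of a preconnected set is chain-connected**: for `S` preconnected,
`S ⊆ ⋃ i, U i` with every `U i` open, `s ∈ S ∩ U i` and `t ∈ S ∩ U j`, the indices `i`, `j` are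
joined by a finite chain along which consecutive members meet inside `S`. Proof: the union `A` of
the members reachable from `i` and the union `B` of the others are open and cover `S`; if `j` were
unreachable, preconnectedness would give a point of `S` in some reachable `U l` and some
unreachable `U l'`, making `l'` reachable. [cite: HatcherAT2002, §3.3 p. 235] -/
theorem IsPreconnected.reflTransGen_of_subset_iUnion {X : Type*} [TopologicalSpace X] {S : Set X}
    (hS : IsPreconnected S) {ι : Type*} {U : ι → Set X} (hU : ∀ i, IsOpen (U i))
    (hcov : S ⊆ ⋃ i, U i) {i j : ι} {s t : X} (hs : s ∈ S) (hsi : s ∈ U i) (ht : t ∈ S)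
    (htj : t ∈ U j) :
    ReflTransGen (fun a b ↦ (U a ∩ U b ∩ S).Nonempty) i j := by
  classical
  by_contra hj
  let A : Set X := ⋃ (l : ι) (_ : ReflTransGen (fun a b ↦ (U a ∩ U b ∩ S).Nonempty) i l), U l
  let B : Set X := ⋃ (l : ι) (_ : ¬ ReflTransGen (fun a b ↦ (U a ∩ U b ∩ S).Nonempty) i l), U l
  have hA : IsOpen A := isOpen_iUnion fun l ↦ isOpen_iUnion fun _ ↦ hU l
  have hB : IsOpen B := isOpen_iUnion fun l ↦ isOpen_iUnion fun _ ↦ hU l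
  have hSAB : S ⊆ A ∪ B := by
    intro x hx
    obtain ⟨l, hl⟩ := mem_iUnion.1 (hcov hx)
    by_cases h : ReflTransGen (fun a b ↦ (U a ∩ U b ∩ S).Nonempty) i l
    · exact Or.inl (mem_iUnion₂.2 ⟨l, h, hl⟩)
    · exact Or.inr (mem_iUnion₂.2 ⟨l, h, hl⟩)
  obtain ⟨x, hxS, hxA, hxB⟩ := hS A B hA hB hSAB ⟨s, hs, mem_iUnion₂.2 ⟨i, ReflTransGen.refl, hsi⟩⟩
    ⟨t, ht, mem_iUnion₂.2 ⟨j, hj, htj⟩⟩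
  obtain ⟨l, hl, hxl⟩ := mem_iUnion₂.1 hxA
  obtain ⟨l', hl', hxl'⟩ := mem_iUnion₂.1 hxB
  exact hl' (hl.tail ⟨x, ⟨hxl, hxl'⟩, hxS⟩)

/-- The same for a cover indexed by a set of open subsets. [cite: HatcherAT2002, §3.3 p. 235] -/
theorem IsPreconnected.reflTransGen_of_subset_sUnion {X : Type*} [TopologicalSpace X] {S : Set X}
    (hS : IsPreconnected S) {𝒰 : Set (Set X)} (hU : ∀ V ∈ 𝒰, IsOpen V) (hcov : S ⊆ ⋃₀ 𝒰)
    {V W : Set X} (hV : V ∈ 𝒰) (hW : W ∈ 𝒰) {s t : X} (hs : s ∈ S) (hsV : s ∈ V) (ht : t ∈ S)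
    (htW : t ∈ W) :
    ReflTransGen (fun a b : 𝒰 ↦ ((a : Set X) ∩ b ∩ S).Nonempty) ⟨V, hV⟩ ⟨W, hW⟩ :=
  IsPreconnected.reflTransGen_of_subset_iUnion hS (U := fun a : 𝒰 ↦ (a : Set X))
    (fun a ↦ hU a a.2) (by rwa [← sUnion_eq_iUnion]) hs hsV ht htW

end Literature.Topology
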